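import Mathlib
import Summits.Schanuel.Schanuel.Theses.MatrixCoefficients

/-!
# Line `hom-structural-rank` for LEAF 1 `HomLogSector` of the grading split of `LogSector` (stmt-Schanuel-4310)

Seat `planner-cstrat-stmt-Schanuel-4310-r1-0` (crux-strategist, BC2 redirect; "a plan for both sides").
LEAF 1 (`HomLogSector`, filed as a child of `MatrixCoefficients.LogSector` in children.json; until the split
lands it is concluded here as its verbatim statement `HomLogSectorStatement`): no nonzero homogeneous
`P ∈ ℚ[X₁..Xₙ]` vanishes at `ℚ`-linearly independent logarithms of algebraic numbers.

THE LINE: Roy's STRUCTURAL-RANK TRANSFER (Roy 1989 = Waldschmidt GL326 §1.4 p. 18; Roy 1995 §3.1 Cor. 3.2;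
Dasgupta 2023 Thm 4.11 / Lemma 4.13): the homogeneous conjecture is EQUIVALENT to "rank = structural rank"
for matrices with entries in `𝓛` (Dasgupta–Kakde 2024 Conj. 1.1), the format of every proved partial result
(six exponentials, Waldschmidt's linear subgroup theorem, Roy's `s ≤ 2·rank` PROVED in the tree as
`Literature.Barriers.Schanuel.roy1995_structuralRank_le_two_mul_rank_holds`, the strong six exponentials
theorem `roy1992_strongSixExponentials_holds`) and of this route's matrix-coefficient ladder
(`MatrixCoefficient`, `SparseVanishing`, `SupportMasser` are statements about singular pencils over `𝓛`).

* `stub_homDetRep` — homogeneous determinantal representation (Valiant, homogenised). Provable now, M.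
* `stub_freshLog` — a logarithm of an algebraic number outside any finite-dimensional `ℚ`-subspace. Provable now, S.
* `stub_squarePencilRigidity` — OPEN, hard: a rational square pencil `Σ λₖBₖ` singular at a `ℚ`-independent
  log point is identically singular (DK Conj. 1.1 for square pencils of full structural rank). WHY EASIER than
  LEAF 1 as typed: it is LEAF 1 in the rank language where `s ≤ 2r` is a theorem, so the open content is
  "remove the factor 2 for square pencils", attackable size by size (`m = 2` is four exponentials verbatim,
  `m = 3` at rank 2 is this route's crux `MatrixCoefficientThree` territory) and by corank (corank `≥ m/2` is
  PROVED by `s ≤ 2r`).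
* `homLogSector_of` — real proof (fresh log in the `x₀` slot makes the homogenised Valiant pencil LINEAR with
  entries in `𝓛`; rigidity kills `x₀^{m−d}·P` identically; specialise `x₀ = 1`).

Costume check: stub 3 ⟺ LEAF 1 modulo stubs 1–2 (a TRANSFER with the why-easier above), not the crux
`LogSector` (the affine/inhomogeneous part is LEAF 2) and not the summit; probes `stub → LEAF 1`,
`stub → Schanuel` by `exact? | simpa | aesop` FAIL (seat bc/ files). Disproof used: none registered.
-/

noncomputable section

set_option linter.dupNamespace false

namespace Summit.Schanuel.Schanuel.Cruxes.LogSector.HomStructuralRank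

/-- LEAF 1 of the grading split, verbatim the child statement `HomLogSector` filed in children.json
(concluded by name here until `route edit --split` writes `MatrixCoefficients.HomLogSector`). -/
def HomLogSectorStatement : Prop :=
  ∀ (n : ℕ) (l : Fin n → ℂ), (∀ i, IsAlgebraic ℚ (Complex.exp (l i))) → LinearIndependent ℚ l →
    ∀ (d : ℕ) (P : MvPolynomial (Fin n) ℚ), P.IsHomogeneous d → P ≠ 0 → MvPolynomial.aeval l P ≠ 0

/-- STUB 1 (provable now, M): homogeneous determinantal representation over `ℚ` — every homogeneous
polynomial of degree `d` in `n` variables is, up to the factor `x₀^{m−d}`, the determinant of a square pencil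
`x₀B₀ + Σᵢ xᵢ₊₁Bᵢ₊₁` of rational matrices (as functions on `ℂⁿ⁺¹`). [Valiant 1979 Thm 1 (universality of the
determinant), homogenised; Dasgupta2023 Lemma 4.13 and proof of Thm 4.11] -/
theorem stub_homDetRep :
    ∀ (n d : ℕ) (P : MvPolynomial (Fin n) ℚ), P.IsHomogeneous d →
      ∃ (m : ℕ) (B : Fin (n + 1) → Matrix (Fin m) (Fin m) ℚ), d ≤ m ∧
        ∀ x : Fin (n + 1) → ℂ,
          (∑ k, x k • (B k).map (algebraMap ℚ ℂ)).det =
            x 0 ^ (m - d) * MvPolynomial.aeval (fun i : Fin n => x i.succ) P := by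
  sorry

/-- STUB 2 (provable now, S): outside the `ℚ`-span of finitely many complex numbers there is a logarithm of
an algebraic number (`𝓛 ⊇ {log p : p prime}` has infinite `ℚ`-dimension by unique factorisation).
[folklore; BakerTNT1975 Ch. 2] -/
theorem stub_freshLog :
    ∀ (n : ℕ) (l : Fin n → ℂ), ∃ μ : ℂ, IsAlgebraic ℚ (Complex.exp μ) ∧
      μ ∉ Submodule.span ℚ (Set.range l) := by
  sorry

/-- STUB 3 (OPEN, hard; TRANSFER of LEAF 1): linear rank rigidity of rational square pencils at points of
`𝓛ⁿ` with `ℚ`-linearly independent coordinates — singular at `λ` ⇒ identically singular. This is the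
Structural Rank Conjecture on `Mat(𝓛)` [DasguptaKakde2024 Conj. 1.1] for square pencils of full structural
rank, equivalent to the homogeneous conjecture of algebraic independence of logarithms [Waldschmidt2000 §1.4
p. 18, after Roy 1989; Roy1995 §3.1 Cor. 3.2]; the tree proves the half `s ≤ 2·rank`
(`roy1995_structuralRank_le_two_mul_rank_holds`). -/
theorem stub_squarePencilRigidity :
    ∀ (n m : ℕ) (B : Fin n → Matrix (Fin m) (Fin m) ℚ) (lam : Fin n → ℂ),
      (∀ i, IsAlgebraic ℚ (Complex.exp (lam i))) → LinearIndependent ℚ lam →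
        (∑ k, lam k • (B k).map (algebraMap ℚ ℂ)).det = 0 →
          ∀ x : Fin n → ℂ, (∑ k, x k • (B k).map (algebraMap ℚ ℂ)).det = 0 := by
  sorry

/-! ### Stub statements by name -/

namespace Statement

/-- Statement of `stub_homDetRep`. -/
abbrev stub_homDetRep : Prop := type_of% @HomStructuralRank.stub_homDetRep
/-- Statement of `stub_freshLog`. -/
abbrev stub_freshLog : Prop := type_of% @HomStructuralRank.stub_freshLog
/-- Statement of `stub_squarePencilRigidity`. -/
abbrev stub_squarePencilRigidity : Prop := type_of% @HomStructuralRank.stub_squarePencilRigidity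

end Statement

/-- COMPOSITION (kernel-checked, no sorry; stub statements BY NAME): LEAF 1 from stubs 1–3 — real
proof: a homogeneous relation of degree `d` at `l` is a singular LINEAR pencil at the `ℚ`-independent log
point `(μ, l)` for a fresh logarithm `μ` (stubs 1, 2), hence an identically singular pencil (stub 3),
hence `P ≡ 0` on `ℂⁿ` (slot `x₀ = 1`), hence `P = 0`. -/
theorem homLogSector_of (h₁ : Statement.stub_homDetRep) (h₂ : Statement.stub_freshLog)
    (h₃ : Statement.stub_squarePencilRigidity) : HomLogSectorStatement := by
  intro n l halg hli d P hP hne hval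
  obtain ⟨m, B, _hdm, hB⟩ := h₁ n d P hP
  obtain ⟨μ, hμalg, hμspan⟩ := h₂ n l
  -- the extended log point (μ, l)
  set lam : Fin (n + 1) → ℂ := Fin.cons μ l with hlam
  have hlam_alg : ∀ i, IsAlgebraic ℚ (Complex.exp (lam i)) := by
    refine Fin.cases ?_ ?_
    · simpa [hlam] using hμalg
    · intro i; simpa [hlam] using halg i
  have hlam_li : LinearIndependent ℚ lam := by
    rw [hlam, linearIndependent_finCons]
    exact ⟨hli, hμspan⟩
  have hdet : (∑ k, lam k • (B k).map (algebraMap ℚ ℂ)).det = 0 := by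
    rw [hB lam]
    have htail : (fun i : Fin n => lam i.succ) = l := by
      funext i; simp [hlam]
    rw [htail, hval, mul_zero]
  have hall := h₃ (n + 1) m B lam hlam_alg hlam_li hdet
  -- P vanishes on ℂⁿ (slot x₀ = 1)
  have hP0 : ∀ y : Fin n → ℂ, MvPolynomial.aeval y P = 0 := fun y => by
    have h := hall (Fin.cons 1 y)
    rw [hB (Fin.cons 1 y)] at h
    simpa using h
  -- hence P = 0
  apply hne
  apply MvPolynomial.map_injective (algebraMap ℚ ℂ) (algebraMap ℚ ℂ).injective
  rw [map_zero]
  apply MvPolynomial.funext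
  intro y
  rw [MvPolynomial.eval_map, ← MvPolynomial.aeval_def, hP0 y, map_zero]

/-- LEAF 1 along this line MODULO exactly the three registered stubs (depends on `sorryAx` only through
`stub_*`). -/
theorem homLogSector_proof : HomLogSectorStatement :=
  homLogSector_of stub_homDetRep stub_freshLog stub_squarePencilRigidity

end Summit.Schanuel.Schanuel.Cruxes.LogSector.HomStructuralRank

end
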